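import Summits.QuantumFields.YangMills.Theorems.FemtoTransferGapLevels
import Summits.QuantumFields.YangMills.Theorems.FemtoTransferGapPositivity
import Summits.QuantumFields.YangMills.Theorems.FemtoTransferGapRungW1up
import HarnessLib

/-!
# Crux RED `RunningReduction`, line «KTR» rev 7, registered stub `TT.stub_oneSiteTail`: a SUFFICIENT CONDITION in pure min–max currency
# (`OneSiteDomination → OneSiteTail`), over tree constants only — TURNKEY for a service seat (owner ym-beyond-p1 g18)

Line «KTR» rev 7 (`pub/ym-beyond/p1-g18-files/Lines-KTR-r7.lean` sha16 d855a771aaa97229, registered 2026-08-27 on stmt-QuantumFields-19978) proves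
`OneSiteLevels → LevelGapSummable → OneSiteTail → OneSiteTraceLimit` and registers the one-site tail bound

  `TT.OneSiteTail := ∀ s > 0, ∀ ε > 0, ∃ K B0, ∀ B ≥ B0, ∀ T : ℕ, s ≤ 2Tλ_b(B) → Summable (k ↦ x_k(B)^T) ∧ Σ_k x_{k+K}(B)^T ≤ ε`,
  `x_k(B) = levelValue su2Rep 1 B k / levelValue su2Rep 1 B 0`, `λ_b = bareLambda`.

This module proves the body of `TT.OneSiteTail` (VERBATIM over tree constants, as the conclusion of `oneSiteTail_of_domination`) from the cleaner
eigenvalue statement `OneSiteDomination` (as its hypothesis, inlined): a `B`-UNIFORM domination `λ_k(B) ≤ e^{−λ_b(B) g(k)} λ_0(B)` for all `k` and all `B ≥ B0`, with `g ≥ 0` Laplace-summable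
(`Σ_k e^{−t g(k)} < ∞` for every `t > 0`) — a uniform Weyl-type LOWER bound on the one-site zero-flux excitation energies in units of `λ_b`, a pure
min–max target for the ONE lineage's machinery (no Euclidean time, no sums).  Proof: `x_k^T ≤ e^{−Tλ_b g(k)} ≤ e^{−(s/2) g(k)}` (as `Tλ_b ≥ s/2`, `g ≥ 0`), comparison
summability, and the tail of the fixed series `Σ e^{−(s/2)g(k+K)} → 0` (`tendsto_sum_nat_add`).
Landed by seat ym-infvol-p2 (owner TURNKEY `p1-g18-files/OneSiteTailOfDomination-scratch.lean`, statement `def`s inlined for the fast lane); proving the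
hypothesis then closes the registered stub `stub_oneSiteTail` by `oneSiteTail_of_domination` (its conclusion is the stub's body verbatim).
HONEST FRAMING: elementary; `OneSiteDomination` itself (M/L: semiclassical min–max comparison on `SU(2)³` uniformly in `B`) is NOT proved here; femto rung R2b1 only; not Clay.
References: [cite: Luscher1983, §1]; [cite: LuscherMunster1984]; [cite: Simon1983, Thm 1.1]; [cite: ReedSimonIV1978, XIII.1].
-/

set_option autoImplicit false

noncomputable section

open Filter Topology
open Literature.MathematicalPhysics.QuantumFieldTheory
open Literature.MathematicalPhysics.QuantumLattice
open Literature.Analysis.OperatorTheory.YMMatrixModel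

namespace Summit.QuantumFields.YangMills.Theorems.FemtoTransferGap.OSTail

/-- ★ **`OneSiteDomination → OneSiteTail`** (owner ym-beyond-p1 g18 TURNKEY, landed by seat ym-infvol-p2 with the two statement `def`s INLINED so that the file
rides the fast lane — a parameter-free `def : Prop` on the Summits side is relocated as a Literature fact by the gate).  HYPOTHESIS = `OneSiteDomination`:
a `B`-uniform domination of the one-site zero-flux transfer values by a Laplace-summable profile, `λ_k(B) ≤ e^{−λ_b(B)·g(k)} λ_0(B)` for all `k` and `B ≥ B0`
(`g ≥ 0`, `Σ_k e^{−t g(k)} < ∞` for every `t > 0`; NOT proved here — M/L semiclassical min–max comparison on `SU(2)³` uniformly in `B`).  CONCLUSION = the body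
of the registered stub `TT.stub_oneSiteTail` of line «KTR» rev 7/8 VERBATIM over tree constants (`x_k(B) = levelValue su2Rep 1 B k / levelValue su2Rep 1 B 0`,
`λ_b = bareLambda`): `x_k^T ≤ e^{−Tλ_b g(k)} ≤ e^{−(s/2) g(k)}` (as `Tλ_b ≥ s/2`, `g ≥ 0`), comparison summability, and the tail of the fixed series
`Σ e^{−(s/2)g(k+K)} → 0` (`tendsto_sum_nat_add`).  Proving the hypothesis closes the stub by this theorem. [cite: Luscher1983, §1] [cite: Simon1983, Thm 1.1] -/
theorem oneSiteTail_of_domination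
    (h : ∃ g : ℕ → ℝ, (∀ k, 0 ≤ g k) ∧ (∀ t : ℝ, 0 < t → Summable fun k : ℕ => Real.exp (-t * g k)) ∧
      ∃ B0 : ℝ, ∀ B : ℝ, B0 ≤ B → ∀ k : ℕ,
        levelValue su2Rep 1 B k ≤ Real.exp (-(bareLambda B * g k)) * levelValue su2Rep 1 B 0) :
    ∀ s : ℝ, 0 < s → ∀ ε : ℝ, 0 < ε → ∃ K : ℕ, ∃ B0 : ℝ, ∀ B : ℝ, B0 ≤ B → ∀ T : ℕ,
      s ≤ 2 * ((T : ℝ) * bareLambda B) →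
        Summable (fun k : ℕ => (levelValue su2Rep 1 B k / levelValue su2Rep 1 B 0) ^ T) ∧
        ∑' k : ℕ, (levelValue su2Rep 1 B (k + K) / levelValue su2Rep 1 B 0) ^ T ≤ ε := by
  obtain ⟨g, hg0, hgsum, B0, hdom⟩ := h
  intro s hs ε hε
  have hs2 : 0 < s / 2 := by positivity
  have hG : Summable (fun k => Real.exp (-(s / 2) * g k)) := hgsum _ hs2
  have hGtail : ∀ᶠ i : ℕ in atTop, ∑' k, Real.exp (-(s / 2) * g (k + i)) < ε :=
    (tendsto_sum_nat_add (fun k => Real.exp (-(s / 2) * g k))).eventually (eventually_lt_nhds hε)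
  obtain ⟨K, hK⟩ := Filter.eventually_atTop.1 hGtail
  refine ⟨K, max B0 1, fun B hB T hT => ?_⟩
  have hB0' : B0 ≤ B := le_trans (le_max_left _ _) hB
  have hB1 : 1 ≤ B := le_trans (le_max_right _ _) hB
  have hBnn : (0 : ℝ) ≤ B := by linarith
  have h0pos : 0 < levelValue su2Rep 1 B 0 := by rw [levelValue_zero]; exact topValue_su2Rep_pos 1 B
  have hx : ∀ k, levelValue su2Rep 1 B k / levelValue su2Rep 1 B 0 ≤ Real.exp (-(bareLambda B * g k)) :=
    fun k => by rw [div_le_iff₀ h0pos]; exact hdom B hB0' k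
  have hx0 : ∀ k, 0 ≤ levelValue su2Rep 1 B k / levelValue su2Rep 1 B 0 := fun k =>
    div_nonneg (levelValue_su2Rep_nonneg 1 hBnn k) (levelValue_su2Rep_nonneg 1 hBnn 0)
  have hTl : s / 2 ≤ (T : ℝ) * bareLambda B := by linarith
  have hxT : ∀ k, (levelValue su2Rep 1 B k / levelValue su2Rep 1 B 0) ^ T ≤ Real.exp (-(s / 2) * g k) := fun k => by
    calc (levelValue su2Rep 1 B k / levelValue su2Rep 1 B 0) ^ T ≤ Real.exp (-(bareLambda B * g k)) ^ T :=
          pow_le_pow_left₀ (hx0 k) (hx k) T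
      _ = Real.exp (-((T : ℝ) * bareLambda B) * g k) := by rw [← Real.exp_nat_mul]; congr 1; ring
      _ ≤ Real.exp (-(s / 2) * g k) := by
          refine Real.exp_le_exp.2 ?_
          have := mul_le_mul_of_nonneg_right hTl (hg0 k)
          linarith
  have hsumT : Summable (fun k : ℕ => (levelValue su2Rep 1 B k / levelValue su2Rep 1 B 0) ^ T) :=
    Summable.of_nonneg_of_le (fun k => pow_nonneg (hx0 k) T) hxT hG
  refine ⟨hsumT, ?_⟩
  have h1 : ∑' k, (levelValue su2Rep 1 B (k + K) / levelValue su2Rep 1 B 0) ^ T ≤ ∑' k, Real.exp (-(s / 2) * g (k + K)) :=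
    Summable.tsum_le_tsum (fun k => hxT (k + K))
      ((summable_nat_add_iff K).2 hsumT) ((summable_nat_add_iff K).2 hG)
  exact h1.trans (hK K le_rfl).le

end Summit.QuantumFields.YangMills.Theorems.FemtoTransferGap.OSTail

end
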